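import Summits.HodgeConjecture.CorCM.Census.TwistGenerationCover

/-!
# Base-block covering: the COVERING half of every column, for an ARBITRARY base type `T₀`

COR-CM (cell `pub-hodgecm2`), count-neutral kernel combinatorics by the binder seat b09 (gen 38; lane TWO-ADIC SPLITTING +
NONDEGENERATE REDUCTION, part C), on top of parts I–III of the uniform twist lane (`Census/TwistGenerationDescent.lean`: the generic `descent`
engine; `Census/TwistGenerationModel.lean`: `ddist`, `ddist_rt`, `ddist_oflipCM_of_mem_sdiff`; `Census/TwistGenerationCover.lean`:
`mem_sdiff_rt_iff`, `not_mem_orb_of_mem`) and `Census/BlockParityLaw.lean` (`Block`, `blk`, `par`) used BY NAME.  One bookkeeping definition with body (`bpot`, the base-block potential) + theorems; no `decide`, no certificate,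
no named fact, no `sorry`.
HONEST FRAMING: `HC_CM` is NOT proved, here or anywhere in the tree; nothing here is a period or a headline.

THE SETTING.  `G` finite, `c : G` with `c² = 1`, abstract CM types `CMF G c`, base change `rt c Q Ψ = Ψ·Q⁻¹`, blocks (orbits of `rt`), the
face relations `gface`, block parities `par`.  Every column of this directory (slices, complements, quartic/octic/uniform twists, dicyclic and
quartic-inversion twists) starts with the same move relative to its own base type: COVER every block far from the base block by one face
lowering a potential.  This file does it ONCE for an ARBITRARY base type `T₀`:

* §1 **The base-block potential** `bpot T₀ Ψ = min_Q ddist (T₀·Q⁻¹) Ψ` — the Hamming distance from `Ψ` to the nearest base change of `T₀`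
  (the conjugate `T̄₀ = T₀·c⁻¹` included, for central `c`); base-change invariant (`bpot_rt`), hence a block invariant (`bpot_eq_of_blk_eq`).
  The RESIDUAL types are those of potential `≤ 1`: the base block and the blocks of the single flips of the base changes of `T₀`.
* §2 **THE COVERING FAMILY** (`exists_cover`): a finite `S ⊆ gfaceSet` with EXACTLY one member per block of potential `≥ 2`
  (`|S| = #{blocks of potential ≥ 2}`), whose block parities are PARITY-INDEPENDENT by the pivot criterion (each member has parity `1` at its
  own block and `0` at every other block of higher-or-equal potential: `par_cover_self`, `par_cover_other`), and such that modulo ANY lattice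
  `L ⊇ ℤ⟨base changes of S⟩` every vector is congruent to one supported on residual types (`descent`), in particular (§3, `exists_cover_residual`)
  `[Φ] ∈ L + ℤ⟨[Ψ] : bpot Ψ ≤ 1⟩` for every type `Φ` — the hypothesis shape of `Nondegenerate.reduction_of_residual` (part A) — so that
  `β(G,c) − r(T₀)` faces always reduce the census to the `r(T₀)` residual blocks, and by parts A–B (for a `2`-group) `μ(G,c) = φ₂(G,c)` follows
  from closing faces which, fibre-independent together with this family, reduce the residual types onto a nondegenerate `T₀` up to a power of `2`.

## References
* [Pohlmann1968] H. Pohlmann, Algebraic cycles on abelian varieties of complex multiplication type, Ann. of Math. 88 (1968), Thm 1.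
* [Milne1999] J. S. Milne, Lefschetz motives and the Tate conjecture, Compositio Math. 117 (1999), Prop. 2.1, p. 54.
-/

namespace Summit.HodgeConjecture.CorCM.Census.BaseBlock

open Finset
open Summit.HodgeConjecture.CorCM.Prior.AllgGroup.RfwfAllgGroup
open Summit.HodgeConjecture.CorCM.Census.BlockParity
open Summit.HodgeConjecture.CorCM.Census.Coinvariant
open Summit.HodgeConjecture.CorCM.Census.TwistGeneration

noncomputable section

variable {G : Type*} [Group G] [Fintype G] [DecidableEq G] (c : G) (T₀ : CMF G c)

/-! ## §1 The base-block potential -/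

/-- **The base-block potential** `bpot T₀ Ψ = min_Q |T₀·Q⁻¹ ∖ Ψ|`: the Hamming distance from `Ψ` to the nearest base change of `T₀`.
[folklore] -/
def bpot (Ψ : CMF G c) : ℕ := univ.inf' ⟨1, mem_univ _⟩ fun Q : G => ddist (rt c Q T₀) Ψ

/-- The potential is at most the distance to any base change of `T₀`. [folklore] -/
theorem bpot_le (Ψ : CMF G c) (Q : G) : bpot c T₀ Ψ ≤ ddist (rt c Q T₀) Ψ :=
  Finset.inf'_le _ (mem_univ Q)

/-- The potential is attained. [folklore] -/
theorem exists_bpot_eq (Ψ : CMF G c) : ∃ Q : G, bpot c T₀ Ψ = ddist (rt c Q T₀) Ψ := by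
  obtain ⟨Q, -, hQ⟩ := Finset.exists_mem_eq_inf' (s := (univ : Finset G)) ⟨1, mem_univ _⟩ (fun Q : G => ddist (rt c Q T₀) Ψ)
  exact ⟨Q, hQ⟩

/-- **The potential is base-change invariant.** [folklore] -/
theorem bpot_rt (Q : G) (Ψ : CMF G c) : bpot c T₀ (rt c Q Ψ) = bpot c T₀ Ψ := by
  apply le_antisymm
  · obtain ⟨Q', hQ'⟩ := exists_bpot_eq c T₀ Ψ
    refine (bpot_le c T₀ (rt c Q Ψ) (Q * Q')).trans ?_
    rw [rt_mul, ddist_rt, ← hQ']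
  · obtain ⟨Q', hQ'⟩ := exists_bpot_eq c T₀ (rt c Q Ψ)
    refine (bpot_le c T₀ Ψ (Q⁻¹ * Q')).trans ?_
    rw [hQ', ← ddist_rt Q (rt c (Q⁻¹ * Q') T₀) Ψ, ← rt_mul, mul_inv_cancel_left]

/-- The potential is a block invariant. [folklore] -/
theorem bpot_eq_of_blk_eq {Ψ Ψ' : CMF G c} (h : blk c Ψ = blk c Ψ') : bpot c T₀ Ψ = bpot c T₀ Ψ' := by
  obtain ⟨Q, rfl⟩ := exists_rt_eq_of_blk_eq c h
  exact (bpot_rt c T₀ Q Ψ).symm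

/-- The block of a block representative. [folklore] -/
theorem blk_out (Bk : Block c) : blk c Bk.out = Bk := Quotient.out_eq Bk

/-- The potential of a block representative is the potential of the block's types. [folklore] -/
theorem bpot_out (Ψ : CMF G c) : bpot c T₀ (blk c Ψ).out = bpot c T₀ Ψ :=
  bpot_eq_of_blk_eq c T₀ (Quotient.out_eq (blk c Ψ))

/-- A type of smaller potential lies in another block. [folklore] -/
theorem blk_ne_of_bpot_lt {Ψ Ψ' : CMF G c} (h : bpot c T₀ Ψ < bpot c T₀ Ψ') : blk c Ψ ≠ blk c Ψ' := fun e => by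
  have := bpot_eq_of_blk_eq c T₀ e; omega

/-! ## §2 The covering family -/

/-- **The choice at a type of potential `≥ 2`**: a nearest base change and two distinct deviation places. [folklore] -/
theorem exists_choice (Ψ : CMF G c) (hΨ : 2 ≤ bpot c T₀ Ψ) :
    ∃ Q : G, ∃ t t' : G, bpot c T₀ Ψ = ddist (rt c Q T₀) Ψ ∧ t ∈ (rt c Q T₀).1 \ Ψ.1 ∧ t' ∈ (rt c Q T₀).1 \ Ψ.1 ∧ t ≠ t' := by
  obtain ⟨Q, hQ⟩ := exists_bpot_eq c T₀ Ψ
  have h2 : 1 < ((rt c Q T₀).1 \ Ψ.1).card := by rw [hQ, ddist] at hΨ; omega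
  obtain ⟨t, ht, t', ht', htt'⟩ := Finset.one_lt_card.mp h2
  exact ⟨Q, t, t', hQ, ht, ht', htt'⟩

/-- **The three corners of a face at two deviation places have smaller potential.** [folklore] -/
theorem bpot_corners_lt (hc2 : c * c = 1) {Ψ : CMF G c} {Q t t' : G} (hQ : bpot c T₀ Ψ = ddist (rt c Q T₀) Ψ)
    (ht : t ∈ (rt c Q T₀).1 \ Ψ.1) (ht' : t' ∈ (rt c Q T₀).1 \ Ψ.1) (htt' : t ≠ t') :
    bpot c T₀ (oflipCM c hc2 t Ψ) < bpot c T₀ Ψ ∧ bpot c T₀ (oflipCM c hc2 t' Ψ) < bpot c T₀ Ψ ∧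
      bpot c T₀ (oflipCM c hc2 t (oflipCM c hc2 t' Ψ)) < bpot c T₀ Ψ := by
  have ht'' : t ∈ (rt c Q T₀).1 \ (oflipCM c hc2 t' Ψ).1 := by
    rw [dev_oflip c hc2 (mem_sdiff.mp ht').1 (mem_sdiff.mp ht').2]; exact mem_erase.mpr ⟨htt', ht⟩
  have d1 := ddist_oflipCM_of_mem_sdiff hc2 ht
  have d2 := ddist_oflipCM_of_mem_sdiff hc2 ht'
  have d3 := ddist_oflipCM_of_mem_sdiff hc2 ht''
  refine ⟨?_, ?_, ?_⟩
  · have := bpot_le c T₀ (oflipCM c hc2 t Ψ) Q; omega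
  · have := bpot_le c T₀ (oflipCM c hc2 t' Ψ) Q; omega
  · have := bpot_le c T₀ (oflipCM c hc2 t (oflipCM c hc2 t' Ψ)) Q; omega

/-- The block parities of a face: `par (gface Φ t t') B = [Φ ∈ B] + [Φ^{(tt')} ∈ B] − [Φ^{(t)} ∈ B] − [Φ^{(t')} ∈ B]`. [folklore] -/
theorem par_gface_apply (hc2 : c * c = 1) (Φ : CMF G c) (t t' : G) (B : Block c) :
    par c (gface c hc2 Φ t t') B = (if blk c Φ = B then 1 else 0) + (if blk c (oflipCM c hc2 t (oflipCM c hc2 t' Φ)) = B then 1 else 0) -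
      (if blk c (oflipCM c hc2 t Φ) = B then 1 else 0) - (if blk c (oflipCM c hc2 t' Φ) = B then 1 else 0) := by
  rw [gface, map_sub, map_sub, map_add]
  simp only [Pi.add_apply, Pi.sub_apply, par_single_apply, Int.cast_one]

/-- **A covering face has parity `1` at its own block** (the three corners lie in blocks of smaller potential). [folklore] -/
theorem par_cover_self (hc2 : c * c = 1) {Ψ : CMF G c} {Q t t' : G} (hQ : bpot c T₀ Ψ = ddist (rt c Q T₀) Ψ)
    (ht : t ∈ (rt c Q T₀).1 \ Ψ.1) (ht' : t' ∈ (rt c Q T₀).1 \ Ψ.1) (htt' : t ≠ t') :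
    par c (gface c hc2 Ψ t t') (blk c Ψ) = 1 := by
  obtain ⟨h1, h2, h3⟩ := bpot_corners_lt c T₀ hc2 hQ ht ht' htt'
  rw [par_gface_apply, if_pos rfl, if_neg (blk_ne_of_bpot_lt c T₀ h3), if_neg (blk_ne_of_bpot_lt c T₀ h1),
    if_neg (blk_ne_of_bpot_lt c T₀ h2)]
  ring

/-- **A covering face has parity `0` at every OTHER block of higher-or-equal potential.** [folklore] -/
theorem par_cover_other (hc2 : c * c = 1) {Ψ : CMF G c} {Q t t' : G} (hQ : bpot c T₀ Ψ = ddist (rt c Q T₀) Ψ)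
    (ht : t ∈ (rt c Q T₀).1 \ Ψ.1) (ht' : t' ∈ (rt c Q T₀).1 \ Ψ.1) (htt' : t ≠ t') {B : Block c} (hB : B ≠ blk c Ψ)
    (hle : bpot c T₀ Ψ ≤ bpot c T₀ B.out) : par c (gface c hc2 Ψ t t') B = 0 := by
  obtain ⟨h1, h2, h3⟩ := bpot_corners_lt c T₀ hc2 hQ ht ht' htt'
  have hne : ∀ {Φ : CMF G c}, bpot c T₀ Φ < bpot c T₀ Ψ → blk c Φ ≠ B := fun {Φ} hΦ e => by
    have := bpot_eq_of_blk_eq c T₀ (e.trans (Quotient.out_eq B).symm); omega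
  rw [par_gface_apply, if_neg (Ne.symm hB), if_neg (hne h3), if_neg (hne h1), if_neg (hne h2)]
  ring

/-- **THE COVERING FAMILY** of the base type `T₀`: EXACTLY one face per block of potential `≥ 2`, parity-independent, reducing every vector to
the residual types (potential `≤ 1`) modulo any lattice containing its base changes. [folklore] -/
theorem exists_cover (hc2 : c * c = 1) :
    ∃ S : Finset (CMF G c →₀ ℤ), (↑S ⊆ gfaceSet G c hc2) ∧
      S.card = (univ.filter fun Bk : Block c => 2 ≤ bpot c T₀ Bk.out).card ∧
      LinearIndepOn (ZMod 2) (fun f : CMF G c →₀ ℤ => par c f) ↑S ∧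
      (∀ f ∈ S, ∃ Ψ : CMF G c, 2 ≤ bpot c T₀ Ψ ∧ par c f (blk c Ψ) = 1 ∧
        ∀ B : Block c, B ≠ blk c Ψ → bpot c T₀ Ψ ≤ bpot c T₀ B.out → par c f B = 0) ∧
      ∀ L : Submodule ℤ (CMF G c →₀ ℤ), Submodule.span ℤ (translates c S) ≤ L →
        ∀ y : CMF G c →₀ ℤ, ∃ y' : CMF G c →₀ ℤ, y - y' ∈ L ∧ ∀ Ψ ∈ y'.support, bpot c T₀ Ψ ≤ 1 := by
  classical
  -- the choice at every block representative of potential `≥ 2`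
  have hch : ∀ Bk : Block c, ∃ τ : G × G × G, 2 ≤ bpot c T₀ Bk.out →
      bpot c T₀ Bk.out = ddist (rt c τ.1 T₀) Bk.out ∧
        τ.2.1 ∈ (rt c τ.1 T₀).1 \ Bk.out.1 ∧ τ.2.2 ∈ (rt c τ.1 T₀).1 \ Bk.out.1 ∧ τ.2.1 ≠ τ.2.2 := by
    intro Bk
    by_cases h : 2 ≤ bpot c T₀ Bk.out
    · obtain ⟨Q, t, t', h1, h3, h4, h5⟩ := exists_choice c T₀ Bk.out h
      exact ⟨(Q, t, t'), fun _ => ⟨h1, h3, h4, h5⟩⟩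
    · exact ⟨(1, 1, 1), fun h' => absurd h' h⟩
  choose τ hτ using hch
  set NI : Finset (Block c) := univ.filter fun Bk : Block c => 2 ≤ bpot c T₀ Bk.out with hNI
  set face : Block c → (CMF G c →₀ ℤ) := fun Bk => gface c hc2 Bk.out (τ Bk).2.1 (τ Bk).2.2 with hfaceDef
  set S : Finset (CMF G c →₀ ℤ) := NI.image face with hS
  -- parities of the block faces
  have hself : ∀ Bk ∈ NI, par c (face Bk) Bk = 1 := by
    intro Bk hBk
    obtain ⟨h1, h3, h4, h5⟩ := hτ Bk (mem_filter.mp hBk).2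
    have h := par_cover_self c T₀ hc2 h1 h3 h4 h5
    rwa [blk_out] at h
  have hother : ∀ Bk ∈ NI, ∀ B : Block c, B ≠ Bk → bpot c T₀ Bk.out ≤ bpot c T₀ B.out → par c (face Bk) B = 0 := by
    intro Bk hBk B hB hle
    obtain ⟨h1, h3, h4, h5⟩ := hτ Bk (mem_filter.mp hBk).2
    exact par_cover_other c T₀ hc2 h1 h3 h4 h5 (by rw [blk_out]; exact hB) hle
  -- the block faces are pairwise distinct
  have hinj : Set.InjOn face ↑NI := by
    intro B₁ hB₁ B₂ hB₂ heq
    by_contra hne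
    rcases le_total (bpot c T₀ B₁.out) (bpot c T₀ B₂.out) with hle | hle
    · have h0 := hother B₁ hB₁ B₂ (Ne.symm hne) hle
      rw [heq, hself B₂ hB₂] at h0
      exact one_ne_zero h0
    · have h0 := hother B₂ hB₂ B₁ hne hle
      rw [← heq, hself B₁ hB₁] at h0
      exact one_ne_zero h0
  have hSsub : (↑S : Set (CMF G c →₀ ℤ)) ⊆ gfaceSet G c hc2 := by
    intro y hy
    obtain ⟨Bk, hBk, rfl⟩ := mem_image.mp (mem_coe.mp hy)
    obtain ⟨-, h3, h4, h5⟩ := hτ Bk (mem_filter.mp hBk).2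
    exact ⟨Bk.out, _, _, not_mem_orb_of_mem (mem_sdiff.mp h3).1 (mem_sdiff.mp h4).1 h5, rfl⟩
  refine ⟨S, hSsub, card_image_of_injOn hinj, ?_, ?_, fun L hL y => ?_⟩
  · -- parity independence by the pivot criterion (pivot = own block, rank = potential)
    set p : (CMF G c →₀ ℤ) → Block c := fun f => if h : ∃ Bk ∈ NI, face Bk = f then h.choose else blk c T₀ with hp
    have hpf : ∀ Bk ∈ NI, p (face Bk) = Bk := by
      intro Bk hBk
      have h : ∃ B ∈ NI, face B = face Bk := ⟨Bk, hBk, rfl⟩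
      rw [hp]; simp only [dif_pos h]
      exact hinj h.choose_spec.1 hBk h.choose_spec.2
    rw [LinearIndepOn, linearIndependent_iff']
    intro t g hsum i₁ hi₁
    by_contra hgi₁
    obtain ⟨i₀, hi₀, hmax⟩ := Finset.exists_max_image (t.filter fun i => g i ≠ 0) (fun i => bpot c T₀ (p i.1).out)
      ⟨i₁, mem_filter.mpr ⟨hi₁, hgi₁⟩⟩
    obtain ⟨hi₀t, hgi₀⟩ := mem_filter.mp hi₀
    obtain ⟨B₀, hB₀, hfB₀⟩ := mem_image.mp i₀.2
    have hp₀ : p i₀.1 = B₀ := by rw [← hfB₀]; exact hpf B₀ hB₀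
    have heval := congrFun hsum B₀
    rw [Finset.sum_apply, Pi.zero_apply, Finset.sum_eq_single_of_mem i₀ hi₀t] at heval
    · rw [Pi.smul_apply, smul_eq_mul, ← hfB₀, hself B₀ hB₀, mul_one] at heval
      exact hgi₀ heval
    · intro j hjt hji
      rw [Pi.smul_apply, smul_eq_mul]
      by_cases hgj : g j = 0
      · rw [hgj, zero_mul]
      · obtain ⟨Bj, hBj, hfBj⟩ := mem_image.mp j.2
        have hpj : p j.1 = Bj := by rw [← hfBj]; exact hpf Bj hBj
        have hlj : bpot c T₀ Bj.out ≤ bpot c T₀ B₀.out := by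
          have h := hmax j (mem_filter.mpr ⟨hjt, hgj⟩)
          rwa [hpj, hp₀] at h
        have hne : B₀ ≠ Bj := fun e => hji (Subtype.ext (by rw [← hfBj, ← hfB₀, e]))
        rw [← hfBj, hother Bj hBj B₀ hne hlj, mul_zero]
  · -- the parity profile of each member
    intro f hf
    obtain ⟨Bk, hBk, rfl⟩ := mem_image.mp hf
    refine ⟨Bk.out, (mem_filter.mp hBk).2, ?_, fun B hB hle => hother Bk hBk B ?_ hle⟩
    · rw [blk_out]; exact hself Bk hBk
    · rw [blk_out] at hB; exact hB
  · -- descent on the potential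
    refine descent c (bpot c T₀) (fun Ψ => bpot c T₀ Ψ ≤ 1) hc2 L (fun Ψ hΨ => ?_) y
    have hΨ2 : 2 ≤ bpot c T₀ Ψ := by omega
    obtain ⟨Q, hQ⟩ := exists_rt_eq_of_blk_eq c (Quotient.out_eq (blk c Ψ) : blk c (blk c Ψ).out = blk c Ψ)
    have hBNI : blk c Ψ ∈ NI := mem_filter.mpr ⟨mem_univ _, by rw [bpot_out]; exact hΨ2⟩
    obtain ⟨h1, h3, h4, h5⟩ := hτ (blk c Ψ) (mem_filter.mp hBNI).2
    set R := (τ (blk c Ψ)).1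
    set t := (τ (blk c Ψ)).2.1
    set t' := (τ (blk c Ψ)).2.2
    have hmem : gface c hc2 Ψ (t * Q⁻¹) (t' * Q⁻¹) ∈ L := by
      have e : gface c hc2 Ψ (t * Q⁻¹) (t' * Q⁻¹) = Finsupp.mapDomain (rt c Q) (face (blk c Ψ)) := by
        rw [mapDomain_rt_gface, hQ]
      rw [e]
      exact hL (Submodule.subset_span ⟨Q, _, mem_image_of_mem _ hBNI, rfl⟩)
    -- the translated choice realises the potential of `Ψ`
    have hQ' : bpot c T₀ Ψ = ddist (rt c (Q * R) T₀) Ψ := by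
      rw [← hQ, bpot_rt, rt_mul, ddist_rt]; exact h1
    have hs : t * Q⁻¹ ∈ (rt c (Q * R) T₀).1 \ Ψ.1 := by
      rw [rt_mul, ← hQ, mem_sdiff_rt_iff, inv_mul_cancel_right]; exact h3
    have hs' : t' * Q⁻¹ ∈ (rt c (Q * R) T₀).1 \ Ψ.1 := by
      rw [rt_mul, ← hQ, mem_sdiff_rt_iff, inv_mul_cancel_right]; exact h4
    have hss' : t * Q⁻¹ ≠ t' * Q⁻¹ := fun h => h5 (mul_right_cancel h)
    exact ⟨t * Q⁻¹, t' * Q⁻¹, hmem, bpot_corners_lt c T₀ hc2 hQ' hs hs' hss'⟩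

/-! ## §3 The residual form -/

/-- A vector supported on a set of types lies in the span of their unit vectors. [folklore] -/
theorem mem_span_single_of_support {Res : Set (CMF G c)} {y : CMF G c →₀ ℤ} (hy : ∀ Ψ ∈ y.support, Ψ ∈ Res) :
    y ∈ Submodule.span ℤ ((fun Ψ => Finsupp.single Ψ (1 : ℤ)) '' Res) := by
  rw [← Finsupp.sum_single y]
  refine Submodule.sum_mem _ fun Ψ hΨ => ?_
  rw [← Finsupp.smul_single_one Ψ (y Ψ)]
  exact Submodule.smul_mem _ _ (Submodule.subset_span ⟨Ψ, hy Ψ hΨ, rfl⟩)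

/-- **Residual form of the covering**: with `S` the covering family of `T₀`, every type satisfies `[Φ] ∈ L + ℤ⟨[Ψ] : bpot Ψ ≤ 1⟩` for every
lattice `L ⊇ ℤ⟨base changes of S⟩` — the first hypothesis of `Nondegenerate.reduction_of_residual`. [folklore] -/
theorem exists_cover_residual (hc2 : c * c = 1) :
    ∃ S : Finset (CMF G c →₀ ℤ), (↑S ⊆ gfaceSet G c hc2) ∧
      S.card = (univ.filter fun Bk : Block c => 2 ≤ bpot c T₀ Bk.out).card ∧
      LinearIndepOn (ZMod 2) (fun f : CMF G c →₀ ℤ => par c f) ↑S ∧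
      (∀ f ∈ S, ∃ Ψ : CMF G c, 2 ≤ bpot c T₀ Ψ ∧ par c f (blk c Ψ) = 1 ∧
        ∀ B : Block c, B ≠ blk c Ψ → bpot c T₀ Ψ ≤ bpot c T₀ B.out → par c f B = 0) ∧
      ∀ L : Submodule ℤ (CMF G c →₀ ℤ), Submodule.span ℤ (translates c S) ≤ L →
        ∀ Φ : CMF G c, Finsupp.single Φ (1 : ℤ) ∈
          L ⊔ Submodule.span ℤ ((fun Ψ => Finsupp.single Ψ (1 : ℤ)) '' {Ψ : CMF G c | bpot c T₀ Ψ ≤ 1}) := by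
  obtain ⟨S, hS, hcard, hli, hprof, hdesc⟩ := exists_cover c T₀ hc2
  refine ⟨S, hS, hcard, hli, hprof, fun L hL Φ => ?_⟩
  obtain ⟨y', hy', hsupp⟩ := hdesc L hL (Finsupp.single Φ 1)
  have e : Finsupp.single Φ (1 : ℤ) = (Finsupp.single Φ 1 - y') + y' := by abel
  rw [e]
  exact Submodule.add_mem _ (Submodule.mem_sup_left hy') (Submodule.mem_sup_right (mem_span_single_of_support c hsupp))

end

end Summit.HodgeConjecture.CorCM.Census.BaseBlock
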